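import Mathlib
import Summits.Ventures.PercRepro2.HCov
import Summits.Ventures.PercRepro2.HCovSwap

/-!
# The two-mark odds lemma (b), its mirror, the case-mean deviations, and `BETWEEN ≥ 0`
(blind cell PercRepro2, mine-a g10 — the lead g23's (J1-K) decomposition, INBOX 22:16Z–22:29Z)

Under `Q = {a₁ ↮ a₂}` (`avoidAll a₂ {a₁}`), with `T′ = Q ∩ {a₃ ∈ C₁}` (`TEvent a₂ a₁ a₃`),
`T = Q ∩ {a₃ ∈ C₂}` (`TEvent a₁ a₂ a₃`), `PD = Q ∩ {a₃ ∉ U}`, `D = P(PD)`, `D_o = P(PD, o ∈ U)`,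
`γ = D_o / D`:

* **(b)** `odds_b`: `P(T′, o ∈ C₂) · D ≤ D_o · P(T′)`, i.e. `γ ≥ P(o ∈ C₂ ∣ a₃ ∈ C₁, Q)`: the
  case-1 mean `η̄₁ = E_μ[H ∣ a₃ ∈ C₁] ≥ 0` of the host-cluster decomposition of the cross term
  (J1).  It is the `a₁ ↔ a₂` mirror of the (C2) step of the MARGIN theorem
  (`CovForm.ToL_mul_D_le`, one instance of BHK06 Thm 1.4 with set avoidance) followed by
  `P(PD, o ∈ C₂) ≤ D_o` — no revealed-cluster identity is needed beyond the one inside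
  `bhk_cross_cluster_avoid`.  **Mirror** `odds_mirror`: `P(T, o ∈ C₁) · D ≤ D_o · P(T)` (`η̄₂ ≤ 0`).
* **Case-mean deviations** `betaDev_nonneg`: `E[σ_b 1_{T′}] · P(Q) ≥ E[σ_b 1_Q] · P(T′)`
  (`β̄₁ ≥ β̄`; BHK 1.2 under `Q` for `{b ∈ C₁}`, `{a₃ ∈ C₁}` and BHK 1.4 with `X = {a₁}` for
  `{b ∈ C₂}`, `{a₃ ∈ C₁}`) and its mirror `betaDev_mirror` (`β̄₂ ≤ β̄`).
* **`between_nonneg`**: the cleared between-case part of `(J1-K)`,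
  `P(Q)² · D · P(T) · P(T′) · BETWEEN`
  `= P(T)·(D_o P(T′) − D P(T′, oH))·(B₁ P(Q) − B P(T′)) + P(T′)·(D P(T, oL) − D_o P(T))·(B₂ P(Q) − B P(T))`
  with `B₁ = E[σ_b 1_{T′}]`, `B₂ = E[σ_b 1_T]`, `B = E[σ_b 1_Q]`, is `≥ 0`: each summand is a
  product of three factors of known sign.  Hence `BETWEEN = Σ_c μ(c)(β̄_c − β̄)(η̄_c − η̄) ≥ 0`
  whenever `P(Q), D, P(T), P(T′) > 0` (the lead's formula
  `BETWEEN = μ(1) η̄₁ (β̄₁ − β̄) + μ(2) η̄₂ (β̄₂ − β̄)`, `η̄₃ = 0`).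
-/

namespace Summit.Ventures.PercRepro2

open UnionCluster

namespace CovForm

section Odds

variable {V : Type*} {E : Type*} [Fintype E] [DecidableEq E] [Fintype V] [DecidableEq V]
  {R : Type*} [Field R] [LinearOrder R] [IsStrictOrderedRing R]

omit [Fintype E] [DecidableEq E] [Fintype V] [DecidableEq V] in
/-- `{a₁ ↮ a₂}` spelled as `Q = avoidAll a₂ {a₁}`. -/
lemma compl_connEvent_eq_Q (ends : E → Sym2 V) (a₁ a₂ : V) :
    (connEvent ends a₁ a₂)ᶜ = avoidAll ends a₂ {a₁} := by
  ext ω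
  simp only [Set.mem_compl_iff, mem_connEvent, mem_avoidAll, Finset.mem_singleton, forall_eq]
  exact ⟨fun h hc => h (conn_symm hc), fun h hc => h (conn_symm hc)⟩

omit [Fintype E] [DecidableEq E] [Fintype V] [DecidableEq V] in
/-- `T′ = Q ∩ {a₃ ∈ C₁}`. -/
lemma TEvent_swap_eq (ends : E → Sym2 V) (a₁ a₂ a₃ : V) :
    TEvent ends a₂ a₁ a₃ = avoidAll ends a₂ {a₁} ∩ connEvent ends a₁ a₃ := by
  unfold TEvent
  rw [compl_connEvent_eq_Q]

omit [Fintype E] [DecidableEq E] [Fintype V] [DecidableEq V] in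
/-- `T = Q ∩ {a₃ ∈ C₂}`. -/
lemma TEvent_eq (ends : E → Sym2 V) (a₁ a₂ a₃ : V) :
    TEvent ends a₁ a₂ a₃ = avoidAll ends a₂ {a₁} ∩ connEvent ends a₂ a₃ := by
  unfold TEvent
  rw [compl_connEvent_eq_Q, avoidAll_root_swap]

omit [Fintype V] [DecidableEq V] [LinearOrder R] [IsStrictOrderedRing R] in
/-- `D_o` is symmetric in the roots. -/
lemma Do_root_swap (p : E → R) (ends : E → Sym2 V) (o a₁ a₂ a₃ : V) :
    Do p ends o a₂ a₁ a₃ = Do p ends o a₁ a₂ a₃ := by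
  unfold Do
  rw [PDEvent_root_swap]
  ring

/-- **Mirror of (b)**: `P(T, o ∈ C₁) · D ≤ D_o · P(T)`, i.e. `γ ≥ P(o ∈ C₁ ∣ a₃ ∈ C₂, Q)`
(`η̄₂ ≤ 0`): the (C2) step of the MARGIN theorem and `P(PD, o ∈ C₁) ≤ D_o`. -/
theorem odds_mirror (p : E → R) (hp : IsProbVec p) (ends : E → Sym2 V) (o a₁ a₂ a₃ : V) :
    prob p (TEvent ends a₁ a₂ a₃ ∩ connEvent ends a₁ o) * prob p (PDEvent ends a₁ a₂ a₃) ≤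
      Do p ends o a₁ a₂ a₃ * prob p (TEvent ends a₁ a₂ a₃) := by
  have h := ToL_mul_D_le p hp ends o a₁ a₂ a₃
  have hT := prob_nonneg hp (TEvent ends a₁ a₂ a₃)
  have hoH := prob_nonneg hp (PDEvent ends a₁ a₂ a₃ ∩ connEvent ends a₂ o)
  have hDo : prob p (PDEvent ends a₁ a₂ a₃ ∩ connEvent ends a₁ o) ≤ Do p ends o a₁ a₂ a₃ := by
    unfold Do
    linarith
  exact h.trans (mul_le_mul_of_nonneg_right hDo hT)

/-- **The two-mark odds lemma (b)**: `P(T′, o ∈ C₂) · D ≤ D_o · P(T′)`, i.e.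
`γ ≥ P(o ∈ C₂ ∣ a₃ ∈ C₁, Q)` (`η̄₁ ≥ 0`): the `a₁ ↔ a₂` mirror of `odds_mirror`. -/
theorem odds_b (p : E → R) (hp : IsProbVec p) (ends : E → Sym2 V) (o a₁ a₂ a₃ : V) :
    prob p (TEvent ends a₂ a₁ a₃ ∩ connEvent ends a₂ o) * prob p (PDEvent ends a₁ a₂ a₃) ≤
      Do p ends o a₁ a₂ a₃ * prob p (TEvent ends a₂ a₁ a₃) := by
  have h := odds_mirror p hp ends o a₂ a₁ a₃
  rwa [PDEvent_root_swap, Do_root_swap] at h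

/-- BHK 1.2 under `Q` for the same-cluster events `{b ∈ C₁}`, `{a₃ ∈ C₁}`:
`P(Q, b ∈ C₁) · P(T′) ≤ P(T′, b ∈ C₁) · P(Q)`. -/
theorem same_bL_a3L (p : E → R) (hp : IsProbVec p) (ends : E → Sym2 V) (a₁ a₂ a₃ b : V) :
    prob p (avoidAll ends a₂ {a₁} ∩ connEvent ends a₁ b) * prob p (TEvent ends a₂ a₁ a₃) ≤
      prob p (TEvent ends a₂ a₁ a₃ ∩ connEvent ends a₁ b) * prob p (avoidAll ends a₂ {a₁}) := by
  have h := bhk_same_cluster_events p hp ends a₁ a₂ (isUpperSet_mem_setOf b)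
    (isUpperSet_mem_setOf a₃)
  rw [← connEvent_eq_clusterInEvent ends a₁ b, ← connEvent_eq_clusterInEvent ends a₁ a₃,
    compl_connEvent_eq_Q] at h
  rw [TEvent_swap_eq]
  have e1 : connEvent ends a₁ b ∩ avoidAll ends a₂ {a₁} =
      avoidAll ends a₂ {a₁} ∩ connEvent ends a₁ b := Set.inter_comm _ _
  have e2 : connEvent ends a₁ a₃ ∩ avoidAll ends a₂ {a₁} =
      avoidAll ends a₂ {a₁} ∩ connEvent ends a₁ a₃ := Set.inter_comm _ _
  have e3 : connEvent ends a₁ b ∩ connEvent ends a₁ a₃ ∩ avoidAll ends a₂ {a₁} =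
      avoidAll ends a₂ {a₁} ∩ connEvent ends a₁ a₃ ∩ connEvent ends a₁ b := by
    ext ω; simp only [Set.mem_inter_iff]; tauto
  rw [e1, e2, e3] at h
  linarith [h]

/-- BHK 1.4 with `X = {a₁}` for the cross-cluster events `{b ∈ C₂}`, `{a₃ ∈ C₁}`:
`P(T′, b ∈ C₂) · P(Q) ≤ P(Q, b ∈ C₂) · P(T′)`. -/
theorem cross_bH_a3L (p : E → R) (hp : IsProbVec p) (ends : E → Sym2 V) (a₁ a₂ a₃ b : V) :
    prob p (TEvent ends a₂ a₁ a₃ ∩ connEvent ends a₂ b) * prob p (avoidAll ends a₂ {a₁}) ≤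
      prob p (avoidAll ends a₂ {a₁} ∩ connEvent ends a₂ b) * prob p (TEvent ends a₂ a₁ a₃) := by
  have h := bhk_cross_cluster_avoid p hp ends a₂ a₁ (X := {a₁}) (Finset.mem_singleton_self a₁)
    (isUpperSet_mem_setOf b) (isUpperSet_mem_setOf a₃)
  rw [← connEvent_eq_clusterInEvent ends a₂ b, ← connEvent_eq_clusterInEvent ends a₁ a₃] at h
  rw [TEvent_swap_eq]
  have e1 : connEvent ends a₂ b ∩ connEvent ends a₁ a₃ ∩ avoidAll ends a₂ {a₁} =
      avoidAll ends a₂ {a₁} ∩ connEvent ends a₁ a₃ ∩ connEvent ends a₂ b := by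
    ext ω; simp only [Set.mem_inter_iff]; tauto
  have e2 : connEvent ends a₂ b ∩ avoidAll ends a₂ {a₁} =
      avoidAll ends a₂ {a₁} ∩ connEvent ends a₂ b := Set.inter_comm _ _
  have e3 : connEvent ends a₁ a₃ ∩ avoidAll ends a₂ {a₁} =
      avoidAll ends a₂ {a₁} ∩ connEvent ends a₁ a₃ := Set.inter_comm _ _
  rw [e1, e2, e3] at h
  exact h

/-- **The case-1 mean deviation `β̄₁ ≥ β̄`**, cleared:
`E[σ_b 1_{T′}] · P(Q) ≥ E[σ_b 1_Q] · P(T′)` with `σ_b = 1_{b ∈ C₁} − 1_{b ∈ C₂}`. -/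
theorem betaDev_nonneg (p : E → R) (hp : IsProbVec p) (ends : E → Sym2 V) (a₁ a₂ a₃ b : V) :
    (prob p (avoidAll ends a₂ {a₁} ∩ connEvent ends a₁ b) -
        prob p (avoidAll ends a₂ {a₁} ∩ connEvent ends a₂ b)) * prob p (TEvent ends a₂ a₁ a₃) ≤
      (prob p (TEvent ends a₂ a₁ a₃ ∩ connEvent ends a₁ b) -
        prob p (TEvent ends a₂ a₁ a₃ ∩ connEvent ends a₂ b)) * prob p (avoidAll ends a₂ {a₁}) := by
  have h1 := same_bL_a3L p hp ends a₁ a₂ a₃ b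
  have h2 := cross_bH_a3L p hp ends a₁ a₂ a₃ b
  linarith [h1, h2]

/-- **The case-2 mean deviation `β̄₂ ≤ β̄`**, cleared (the `a₁ ↔ a₂` mirror):
`E[σ_b 1_T] · P(Q) ≤ E[σ_b 1_Q] · P(T)`. -/
theorem betaDev_mirror (p : E → R) (hp : IsProbVec p) (ends : E → Sym2 V) (a₁ a₂ a₃ b : V) :
    (prob p (TEvent ends a₁ a₂ a₃ ∩ connEvent ends a₁ b) -
        prob p (TEvent ends a₁ a₂ a₃ ∩ connEvent ends a₂ b)) * prob p (avoidAll ends a₂ {a₁}) ≤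
      (prob p (avoidAll ends a₂ {a₁} ∩ connEvent ends a₁ b) -
        prob p (avoidAll ends a₂ {a₁} ∩ connEvent ends a₂ b)) * prob p (TEvent ends a₁ a₂ a₃) := by
  have h := betaDev_nonneg p hp ends a₂ a₁ a₃ b
  rw [avoidAll_root_swap] at h
  linarith [h]

/-- **`BETWEEN ≥ 0`** (cleared by `P(Q)² · D · P(T) · P(T′)`): the between-case part of the
host-cluster decomposition of the cross term (J1),
`P(T)·(D_o P(T′) − D P(T′, oH))·(B₁ P(Q) − B P(T′)) + P(T′)·(D P(T, oL) − D_o P(T))·(B₂ P(Q) − B P(T)) ≥ 0`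
with `B₁ = E[σ_b 1_{T′}]`, `B₂ = E[σ_b 1_T]`, `B = E[σ_b 1_Q]`; every factor has the sign given by
`odds_b` / `odds_mirror` / `betaDev_nonneg` / `betaDev_mirror`. -/
theorem between_nonneg (p : E → R) (hp : IsProbVec p) (ends : E → Sym2 V) (o a₁ a₂ a₃ b : V) :
    0 ≤ prob p (TEvent ends a₁ a₂ a₃) *
          (Do p ends o a₁ a₂ a₃ * prob p (TEvent ends a₂ a₁ a₃) -
            prob p (PDEvent ends a₁ a₂ a₃) * prob p (TEvent ends a₂ a₁ a₃ ∩ connEvent ends a₂ o)) *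
          ((prob p (TEvent ends a₂ a₁ a₃ ∩ connEvent ends a₁ b) -
              prob p (TEvent ends a₂ a₁ a₃ ∩ connEvent ends a₂ b)) * prob p (avoidAll ends a₂ {a₁}) -
            (prob p (avoidAll ends a₂ {a₁} ∩ connEvent ends a₁ b) -
              prob p (avoidAll ends a₂ {a₁} ∩ connEvent ends a₂ b)) * prob p (TEvent ends a₂ a₁ a₃)) +
        prob p (TEvent ends a₂ a₁ a₃) *
          (prob p (PDEvent ends a₁ a₂ a₃) * prob p (TEvent ends a₁ a₂ a₃ ∩ connEvent ends a₁ o) -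
            Do p ends o a₁ a₂ a₃ * prob p (TEvent ends a₁ a₂ a₃)) *
          ((prob p (TEvent ends a₁ a₂ a₃ ∩ connEvent ends a₁ b) -
              prob p (TEvent ends a₁ a₂ a₃ ∩ connEvent ends a₂ b)) * prob p (avoidAll ends a₂ {a₁}) -
            (prob p (avoidAll ends a₂ {a₁} ∩ connEvent ends a₁ b) -
              prob p (avoidAll ends a₂ {a₁} ∩ connEvent ends a₂ b)) * prob p (TEvent ends a₁ a₂ a₃)) := by
  have hT := prob_nonneg hp (TEvent ends a₁ a₂ a₃)
  have hT' := prob_nonneg hp (TEvent ends a₂ a₁ a₃)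
  have h1 : 0 ≤ Do p ends o a₁ a₂ a₃ * prob p (TEvent ends a₂ a₁ a₃) -
      prob p (PDEvent ends a₁ a₂ a₃) * prob p (TEvent ends a₂ a₁ a₃ ∩ connEvent ends a₂ o) := by
    have := odds_b p hp ends o a₁ a₂ a₃
    linarith [this]
  have h2 : 0 ≤ (prob p (TEvent ends a₂ a₁ a₃ ∩ connEvent ends a₁ b) -
        prob p (TEvent ends a₂ a₁ a₃ ∩ connEvent ends a₂ b)) * prob p (avoidAll ends a₂ {a₁}) -
      (prob p (avoidAll ends a₂ {a₁} ∩ connEvent ends a₁ b) -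
        prob p (avoidAll ends a₂ {a₁} ∩ connEvent ends a₂ b)) * prob p (TEvent ends a₂ a₁ a₃) := by
    have := betaDev_nonneg p hp ends a₁ a₂ a₃ b
    linarith [this]
  have h3 : prob p (PDEvent ends a₁ a₂ a₃) * prob p (TEvent ends a₁ a₂ a₃ ∩ connEvent ends a₁ o) -
      Do p ends o a₁ a₂ a₃ * prob p (TEvent ends a₁ a₂ a₃) ≤ 0 := by
    have := odds_mirror p hp ends o a₁ a₂ a₃
    linarith [this]
  have h4 : (prob p (TEvent ends a₁ a₂ a₃ ∩ connEvent ends a₁ b) -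
        prob p (TEvent ends a₁ a₂ a₃ ∩ connEvent ends a₂ b)) * prob p (avoidAll ends a₂ {a₁}) -
      (prob p (avoidAll ends a₂ {a₁} ∩ connEvent ends a₁ b) -
        prob p (avoidAll ends a₂ {a₁} ∩ connEvent ends a₂ b)) * prob p (TEvent ends a₁ a₂ a₃) ≤ 0 := by
    have := betaDev_mirror p hp ends a₁ a₂ a₃ b
    linarith [this]
  have hA := mul_nonneg hT (mul_nonneg h1 h2)
  have hB := mul_nonneg hT' (mul_nonneg_of_nonpos_of_nonpos h3 h4)
  linarith [hA, hB]

end Odds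

end CovForm

end Summit.Ventures.PercRepro2
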